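import Mathlib
import HarnessLib
import Summits.HubbardSuperconductivity.HubbardSuperconductivity.Theorems.KLProgrammeC4aCoMovingBridge

/-!
# Route `KLProgramme` — crux C4a, S3 brick (B4) «(U1)-HYBRID», «SWAP-BY-SYMMETRY» part 5: the first-order layer of a PARTNER-FAR piece is elementary —
# `∫_{(0,2π]} |∫_{−hi}^{hi} wt ∫_{−π}^{π} J·G·(K e)′(ē)| ≤ 2π·(2hi·W)·(2π·J₀·K₁S₁·C₁)` when `|(K e)′| ≤ C₁` everywhere

Cell `gate-hubbard-kl`, seat hubbard-kl-k3c3-p3 (g38; row «implicit-function / monotonicity route for μ(n)»).  Located brick for the (C)-closer lane / the `M₁` assembly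
(stub (C) `stub_twoLeg_curvature` of `KLRegimeEngineV17F2`, stmt-HubbardSuperconductivity-20437), memo HOME/hubbard-kl-k3c3-p3/SWAP-BY-SYMMETRY.md.
In the symmetric organisation (`…C4aBubbleSwapSymmetry.zoneBox_ppTrueKernel_eq_symmetricCutoff_add_complement`) the complement of the symmetric cut-off is
`2·𝐁[χ(e)(1 − χ(ē))·P] + 𝐁[(1−χ)⊗(1−χ)·P]`: in the first piece the PARTNER level stays in `supp (1 − χ)`, off the Fermi curve by `≥ r′/2`, where the kernel family
`u ↦ (1 − χ(u))·P(e,u)` is `C¹` with an `n`-free bound `|∂ᵤ| ≤ C₁` for EVERY loop level (value and derivative envelopes of `P` at `|u| ≥ r′/2`, e.g.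
`abs_ppTrueKernelDu_le_inv_max_sq` with `c = r′/(2hi)`).  For such a family the first-order layer of `…C4aFirstOrderLayerSum.firstOrderLayer_abs_le`'s LEFT-HAND SIDE needs
no umklapp / tangency / Cooper analysis at all: it is bounded pointwise in `ϑ`.
* **`farPartner_levelBox_abs_le`** — `|∫_{−hi}^{hi} wt(e) ∫_{−π}^{π} J(e,v)·G(ϑ,e,v)·(K e)′(ē) dv de| ≤ 2hi·W·(2π·J₀·(K₁S₁)·C₁)` for every `ϑ`
  (`G = De_K(S(ϑ) − Φ(e,v+θ))[S′(ϑ)]`, `|G| ≤ K₁·S₁` from `‖De_K‖ ≤ K₁` and `‖S′‖ ≤ S₁`);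
* **`farPartner_firstOrderLayer_abs_le`** (HEADLINE) — the `ϑ`-integral over `(0, 2π]` of the absolute value is `≤ 2π` times that.
Shape: the integrand is LITERALLY that of `firstOrderLayer_abs_le`'s conclusion (`Jw`, `Kr`, `wt`, `pairSumPath`, `levelPoint`, `frameLevel`), so the closer sums the two
bounds in the `i = 1` row of `CoMovingJetsL1Theta` via B-1 (xi) `…C4aFirstOrderTubePieceFamily`.
Elementary estimates (`norm_integral_le_of_norm_le_const`, `integral_mono_of_nonneg` — no measurability of the integrand is needed); nothing about the model's sizes;
nothing asserts (C), K3, the window or superconductivity.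
References: FST II CPAM 51 (1998) §3 [cite: FeldmanSalmhoferTrubowitz1998]; BGM 2006 §2.4 (2.36) [cite: BenfattoGiulianiMastropietro2006].
-/

noncomputable section

namespace Summit.HubbardSuperconductivity.HubbardSuperconductivity.Theorems.C4a

set_option linter.dupNamespace false -- summit = problem name (single-conjunct summit), D-0017

open Real Set Filter MeasureTheory intervalIntegral
open scoped Topology Interval
open Literature.MathematicalPhysics.QuantumLattice Literature.MathematicalPhysics.QuantumLattice.BandSectorCounting Literature.Probability.LatticeModels
open Summit.HubbardSuperconductivity.HubbardSuperconductivity.Theorems.KLRegimeSplit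
open Summit.HubbardSuperconductivity.HubbardSuperconductivity.Theorems.DispersionFlow
open Summit.HubbardSuperconductivity.HubbardSuperconductivity.Theorems.PerturbedFermiCurve

section FarPartner

variable (μ : ℝ) (K : TrigPolyC4v) {K₁ : ℝ} (hK₁ : ∀ p : Momentum, ‖fderiv ℝ (frameLevel μ K) p‖ ≤ K₁)
  {hi : ℝ} (hhi : 0 ≤ hi) (ρ θ : ℝ) {S₁ : ℝ} (hS₁ : ∀ ϑ, ‖iteratedDeriv 1 (levelPoint μ K 0) θ + iteratedDeriv 1 (levelPoint μ K ρ) (ϑ + θ)‖ ≤ S₁)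
  {wt : ℝ → ℝ} {W : ℝ} (hwW : ∀ e ∈ Icc (-hi) hi, |wt e| ≤ W)
  {Jw : ℝ → ℝ → ℝ} {J₀ : ℝ} (hJb : ∀ e ∈ Icc (-hi) hi, ∀ v, |Jw e v| ≤ J₀)
  {Kr : ℝ → ℝ → ℝ} {C₁ : ℝ} (hK1far : ∀ e ∈ Icc (-hi) hi, ∀ u, |deriv (Kr e) u| ≤ C₁)

include hK₁ hS₁ in
/-- The geometric factor `G(ϑ,e,v) = De_K(S(ϑ) − Φ(e, v+θ))[S′(ϑ)]` is bounded by `K₁·S₁`. -/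
theorem abs_geomFactor_le_of_norms (ϑ e v : ℝ) :
    |(fderiv ℝ (frameLevel μ K) (pairSumPath μ K ρ ϑ θ 0 - levelPoint μ K e (v + θ)))
        (iteratedDeriv 1 (levelPoint μ K 0) θ + iteratedDeriv 1 (levelPoint μ K ρ) (ϑ + θ))| ≤ K₁ * S₁ := by
  rw [← Real.norm_eq_abs]
  refine (ContinuousLinearMap.le_opNorm _ _).trans ?_
  have hK0 : 0 ≤ K₁ := (norm_nonneg _).trans (hK₁ 0)
  exact mul_le_mul (hK₁ _) (hS₁ ϑ) (norm_nonneg _) hK0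

include hK₁ hhi hS₁ hwW hJb hK1far in
/-- **The level box of a partner-far piece, pointwise in `ϑ`**: with `|(K e)′| ≤ C₁` for every loop level of the box and every partner level,
`|∫_{−hi}^{hi} wt ∫_{−π}^{π} J·G·(K e)′(ē)| ≤ 2hi·(W·(2π·(J₀·(K₁S₁)·C₁)))`. -/
theorem farPartner_levelBox_abs_le (ϑ : ℝ) :
    |∫ e in (-hi)..hi, wt e * ∫ v in (-π)..π,
        Jw e v * ((fderiv ℝ (frameLevel μ K) (pairSumPath μ K ρ ϑ θ 0 - levelPoint μ K e (v + θ)))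
          (iteratedDeriv 1 (levelPoint μ K 0) θ + iteratedDeriv 1 (levelPoint μ K ρ) (ϑ + θ))) *
          deriv (Kr e) (frameLevel μ K (pairSumPath μ K ρ ϑ θ 0 - levelPoint μ K e (v + θ)))| ≤
      2 * hi * (W * (2 * π * (J₀ * (K₁ * S₁) * C₁))) := by
  have hJ0 : 0 ≤ J₀ := (abs_nonneg _).trans (hJb 0 ⟨by linarith, hhi⟩ 0)
  have hC0 : 0 ≤ C₁ := (abs_nonneg _).trans (hK1far 0 ⟨by linarith, hhi⟩ 0)
  have hKS : 0 ≤ K₁ * S₁ := (abs_nonneg _).trans (abs_geomFactor_le_of_norms μ K hK₁ ρ θ hS₁ ϑ 0 0)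
  -- inner loop integral, per level of the box
  have hinner : ∀ e ∈ Icc (-hi) hi, |∫ v in (-π)..π,
      Jw e v * ((fderiv ℝ (frameLevel μ K) (pairSumPath μ K ρ ϑ θ 0 - levelPoint μ K e (v + θ)))
        (iteratedDeriv 1 (levelPoint μ K 0) θ + iteratedDeriv 1 (levelPoint μ K ρ) (ϑ + θ))) *
        deriv (Kr e) (frameLevel μ K (pairSumPath μ K ρ ϑ θ 0 - levelPoint μ K e (v + θ)))| ≤ 2 * π * (J₀ * (K₁ * S₁) * C₁) := fun e he => by
    have hb : ∀ v ∈ Ι (-π) π, ‖Jw e v * ((fderiv ℝ (frameLevel μ K) (pairSumPath μ K ρ ϑ θ 0 - levelPoint μ K e (v + θ)))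
        (iteratedDeriv 1 (levelPoint μ K 0) θ + iteratedDeriv 1 (levelPoint μ K ρ) (ϑ + θ))) *
        deriv (Kr e) (frameLevel μ K (pairSumPath μ K ρ ϑ θ 0 - levelPoint μ K e (v + θ)))‖ ≤ J₀ * (K₁ * S₁) * C₁ := fun v _ => by
      rw [Real.norm_eq_abs, abs_mul, abs_mul]
      exact mul_le_mul (mul_le_mul (hJb e he v) (abs_geomFactor_le_of_norms μ K hK₁ ρ θ hS₁ ϑ e v) (abs_nonneg _) hJ0) (hK1far e he _)
        (abs_nonneg _) (mul_nonneg hJ0 hKS)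
    have h := intervalIntegral.norm_integral_le_of_norm_le_const hb
    rw [Real.norm_eq_abs, show π - -π = 2 * π by ring, abs_of_pos (by positivity : (0 : ℝ) < 2 * π)] at h
    linarith [h]
  -- the level integral
  have hb : ∀ e ∈ Ι (-hi) hi, ‖wt e * ∫ v in (-π)..π,
      Jw e v * ((fderiv ℝ (frameLevel μ K) (pairSumPath μ K ρ ϑ θ 0 - levelPoint μ K e (v + θ)))
        (iteratedDeriv 1 (levelPoint μ K 0) θ + iteratedDeriv 1 (levelPoint μ K ρ) (ϑ + θ))) *
        deriv (Kr e) (frameLevel μ K (pairSumPath μ K ρ ϑ θ 0 - levelPoint μ K e (v + θ)))‖ ≤ W * (2 * π * (J₀ * (K₁ * S₁) * C₁)) := fun e he => by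
    have he' : e ∈ Icc (-hi) hi := by rw [uIoc_of_le (by linarith : -hi ≤ hi)] at he; exact ⟨he.1.le, he.2⟩
    rw [Real.norm_eq_abs, abs_mul]
    exact mul_le_mul (hwW e he') (hinner e he') (abs_nonneg _) ((abs_nonneg _).trans (hwW e he'))
  have h := intervalIntegral.norm_integral_le_of_norm_le_const hb
  rw [Real.norm_eq_abs, show hi - -hi = 2 * hi by ring, abs_of_nonneg (by linarith : (0 : ℝ) ≤ 2 * hi)] at h
  linarith [h]

include hK₁ hhi hS₁ hwW hJb hK1far in
/-- **THE FIRST-ORDER LAYER OF A PARTNER-FAR PIECE** (HEADLINE; the left-hand side is `firstOrderLayer_abs_le`'s): with `|(K e)′| ≤ C₁` for every loop level of the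
box and every partner level, `∫_{(0,2π]} |∫_{−hi}^{hi} wt ∫_{−π}^{π} J·G·(K e)′(ē)| dϑ ≤ 2π·(2hi·(W·(2π·(J₀·(K₁S₁)·C₁))))` — no caustic analysis: the partner never
reaches its Fermi curve. [cite: FeldmanSalmhoferTrubowitz1998, §3] -/
theorem farPartner_firstOrderLayer_abs_le :
    ∫ ϑ in Ioc 0 (2 * π), |∫ e in (-hi)..hi, wt e * ∫ v in (-π)..π,
        Jw e v * ((fderiv ℝ (frameLevel μ K) (pairSumPath μ K ρ ϑ θ 0 - levelPoint μ K e (v + θ)))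
          (iteratedDeriv 1 (levelPoint μ K 0) θ + iteratedDeriv 1 (levelPoint μ K ρ) (ϑ + θ))) *
          deriv (Kr e) (frameLevel μ K (pairSumPath μ K ρ ϑ θ 0 - levelPoint μ K e (v + θ)))| ≤
      2 * π * (2 * hi * (W * (2 * π * (J₀ * (K₁ * S₁) * C₁)))) := by
  set M : ℝ := 2 * hi * (W * (2 * π * (J₀ * (K₁ * S₁) * C₁))) with hM
  have hpt : ∀ ϑ, |∫ e in (-hi)..hi, wt e * ∫ v in (-π)..π,
      Jw e v * ((fderiv ℝ (frameLevel μ K) (pairSumPath μ K ρ ϑ θ 0 - levelPoint μ K e (v + θ)))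
        (iteratedDeriv 1 (levelPoint μ K 0) θ + iteratedDeriv 1 (levelPoint μ K ρ) (ϑ + θ))) *
        deriv (Kr e) (frameLevel μ K (pairSumPath μ K ρ ϑ θ 0 - levelPoint μ K e (v + θ)))| ≤ M := fun ϑ =>
    farPartner_levelBox_abs_le μ K hK₁ hhi ρ θ hS₁ hwW hJb hK1far ϑ
  have hfin : volume (Ioc 0 (2 * π)) < ⊤ := measure_Ioc_lt_top
  have hint : IntegrableOn (fun _ : ℝ => M) (Ioc 0 (2 * π)) := integrableOn_const hfin.ne
  calc ∫ ϑ in Ioc 0 (2 * π), |∫ e in (-hi)..hi, wt e * ∫ v in (-π)..π,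
        Jw e v * ((fderiv ℝ (frameLevel μ K) (pairSumPath μ K ρ ϑ θ 0 - levelPoint μ K e (v + θ)))
          (iteratedDeriv 1 (levelPoint μ K 0) θ + iteratedDeriv 1 (levelPoint μ K ρ) (ϑ + θ))) *
          deriv (Kr e) (frameLevel μ K (pairSumPath μ K ρ ϑ θ 0 - levelPoint μ K e (v + θ)))|
      ≤ ∫ _ in Ioc 0 (2 * π), M := by
        refine integral_mono_of_nonneg (Eventually.of_forall fun ϑ => abs_nonneg _) hint (Eventually.of_forall fun ϑ => hpt ϑ)
    _ = 2 * π * M := by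
        rw [setIntegral_const, Real.volume_real_Ioc_of_le (by positivity : (0 : ℝ) ≤ 2 * π), sub_zero, smul_eq_mul]

end FarPartner

end Summit.HubbardSuperconductivity.HubbardSuperconductivity.Theorems.C4a

end
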